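import Literature.Combinatorics.Optimization.EdmondsMatchingPolytope
import Literature.Combinatorics.Optimization.PsdLiftProductsAndSums
import Literature.Barriers.PneNP.TSPExtensionComplexityFaces
import Literature.Barriers.PneNP.ExtendedFormulationLinearImage
import HarnessLib

/-!
# Approximate extended formulations of the matching polytope restrict to subgraphs
# (Rothvoß 2017, §4: the `(1+ε)`-approximation notion for monotone polytopes, its objective-function
# criterion, and the reduction in the proof of Corollary 17)

[topic Combinatorics/Optimization]

T. Rothvoß, *The matching polytope has exponential extension complexity*, J. ACM 64 (2017) =
arXiv:1311.2369 [Rothvoss2017] (held text `paper:arxiv-1311.2369`; locators = chunks `pNNNN Lk` of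
the lit-read materialisation = PDF pages), **§4 "Inapproximability of the matching polytope"**
(p0013), verbatim:

> (L3–8) "we want to discuss the inapproximability for `P_M`, which is the convex hull of all
> matchings in `G` (not just the perfect ones). The polytope `P_M` has the nice property that it is
> monotone, which means that for `x ∈ P_M` and `0 ≤ y ≤ x` one also has `y ∈ P_M`. We say that a
> polytope `K` is a `(1+ε)`-approximation to `P_M` if `P_M ⊆ K ⊆ (1+ε) P_M` (note that this only makes
> sense for monotone polytopes)."
> (L10–17, eq. (4)) "This is equivalent to requiring that for each objective function `c ∈ ℝ^E_{≥ 0}`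
> one has `max{cx | x ∈ P_M} ≤ max{cx | x ∈ K} ≤ (1+ε) · max{cx | x ∈ P_M}`, where we use again
> monotonicity."
> (Corollary 17, L37–63) "Let `G = (V,E)` be the complete graph on `n` nodes and let `P_M` be the
> convex hull of all matchings. Let `K` be a polytope with `P_M ⊆ K ⊆ (1+ε) P_M`. Then
> `xc(K) ≥ 2^{Ω(min{1/ε, n})}`. *Proof.* […] Suppose that we have a polytope
> `K = {x ∈ ℝ^E : ∃ y : (x,y) ∈ Q}` with `P_M(G) ⊆ K ⊆ (1+ε) · P_M(G)` so that `Q` has `xc(K)` many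
> facets. Take any set `V' ⊆ V` of `k := ½⌊1/ε⌋` vertices and let `G' = (V',E')` be the induced
> subgraph. For a vector `x ∈ ℝ^E`, we write `x = (x',x'')` with `x' ∈ ℝ^{E'}` and `x'' ∈ ℝ^{E/E'}`.
> Then `K' := {x' ∈ ℝ^{E'} | ∃ y : ((x',0),y) ∈ Q}` is a polytope with `xc(K') ≤ xc(K)`. Intuitively,
> `K'` emerges from `K` by 'deleting' variables for edges that are not in `G'`. But `K'` is still an
> approximation to the matching polytope for `G'`; formally `P_M(G') ⊆ K' ⊆ (1+ε) P_M(G')`. […] hence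
> we can apply the original result of Braun and Pokutta to the graph `G'` and obtain that
> `xc(K') ≥ 2^{Ω(|V'|)}`."

This file PROVES (no named facts), in the currency of the tree — the matching polytope of a finite
simple graph `G` on `V` is Edmonds' polyhedron `StephenTuncel1999.edmondsPolytope G ⊆ ℝ^{E(G)}`
(`= conv(matching vectors)`, Edmonds' theorem, PROVED in `EdmondsMatchingPolytope.lean`), an extended
formulation of size `r` is `Literature.Barriers.PneNP.HasEFOfSize K r`, and a `(1+ε)`-approximation is
the pair of inclusions `P_M(G) ⊆ K`, `K ⊆ (1+ε) • P_M(G)` exactly as in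
`MatchingPolytopeRelaxationScheme.lean` (the UPPER bound of the approximation spectrum):

§1 Monotone polytopes and criterion (4).
* `IsDownMonotone P` — "`x ∈ P` and `0 ≤ y ≤ x` implies `y ∈ P`" (a predicate);
  `isDownMonotone_edmondsPolytope` ("`P_M` is monotone"), `IsDownMonotone.smul`,
  `isCompact_edmondsPolytope` / `isClosed_edmondsPolytope` (a convex hull of finitely many points).
* `IsDownMonotone.mem_of_forall_dotProduct_le` — the separation fact behind "where we use again
  monotonicity": a nonnegative point outside a closed convex down-monotone subset of `ℝ^ι_{≥0}` is
  cut off by a NONNEGATIVE objective function (Hahn–Banach, then replace `c` by `c⁺`);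
  `IsDownMonotone.subset_iff_forall_dotProduct_le` (inclusion of such sets is decided by nonnegative
  objective functions) and **`approximation_iff_objective`** — criterion (4): for a closed convex
  down-monotone `K ⊆ ℝ^E_{≥0}` and `ε ≥ 0`, `P_M ⊆ K ⊆ (1+ε)P_M` iff for every `c ≥ 0`,
  `max_{P_M} c ≤ max_K c ≤ (1+ε) max_{P_M} c` (written pointwise with `∃`-witnesses, which is the same
  thing for compact sets).
§2 Corollary 17's reduction, for an ARBITRARY subgraph `H ≤ G` on the same vertex set (the printed
  case is `G = K_n`, `H` = the complete graph on `V' ⊆ V` together with the isolated vertices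
  `V ∖ V'`, whose matching polytope is that of `K_{|V'|}`).
* `edgeIncl`, `extendZero` (`x' ↦ (x',0)`), `restrictEdges` (`x ↦ x'`) and their calculus;
  `extendZero_mem_edmondsPolytope` (`x' ∈ P_M(H) ⇒ (x',0) ∈ P_M(G)`),
  `restrictEdges_mem_edmondsPolytope` (`x ∈ P_M(G) ⇒ x' ∈ P_M(H)`) — both read off Edmonds'
  inequalities;
* `restrictPolytope hHG K = K' = {x' | (x',0) ∈ K}`, `hasEFOfSize_restrictPolytope`
  ("`xc(K') ≤ xc(K)`": `K'` is a coordinate section followed by a coordinate projection of `K`, both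
  free in the slack-form currency: `HasEFOfSize.inter_eqs`, `HasEFOfSize.image_linearMap`);
* **`approximation_restrictPolytope`** ("`P_M(G') ⊆ K' ⊆ (1+ε) P_M(G')`") and the packaged
  **`exists_approximation_of_subgraph`**: a `(1+ε)`-approximation of `P_M(G)` with an extended
  formulation of size `r` yields one of `P_M(H)` of size `r`, for every `H ≤ G` and every real `ε`.

§3 (appended) The SEMIDEFINITE version: psd lifts (`HasPsdLift`, GPT 2013 / FGPRT eq. (3)) restrict
  to subgraphs as well, at NO cost in size — `hasPsdLift_restrictPolytope` (coordinate sections and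
  projections are free for psd lifts: `HasPsdLift.inter_setOf_map_eq`, `HasPsdLift.image`),
  `restrictPolytope_edmondsPolytope` (`K = P_M(G)` restricts to `P_M(H)` exactly),
  **`exists_psdApproximation_of_subgraph`** (a `(1+ε)`-approximation of `P_M(G)` with a psd lift of
  size `k` yields one of `P_M(H)` with a psd lift of size `k`) and `hasPsdLift_edmondsPolytope_of_subgraph`
  (semidefinite extension complexity of matching polytopes is monotone under subgraphs) — the form in
  which lower bounds on the SEMIDEFINITE extension complexity of a matching polytope propagate to
  supergraphs.  (Rothvoß, §4.2, PDF p. 13: "it is still unknown whether there is a polynomial size SDP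
  for the perfect matching polytope"; the reduction is the same as in the LP case.)

WHAT THIS IS NOT: the BASE CASE of Corollary 17 — Braun–Pokutta's theorem (Rothvoß's Thm. 16:
`P_M ⊆ K ⊆ (1 + α/n) P_M ⇒ xc(K) ≥ 2^{c(α) n}` [BraunPokutta2014, Thm. 3.1]) — is NOT in the tree (its
printed proofs, Braun–Pokutta's and Sinha's, are information-theoretic: common information, Pinsker,
direct sums), so Corollary 17 itself is not assembled here; this file is the reduction half of its
proof and the definitional §4 material only.  Nothing here bears on psd rank or on P versus NP.

## References

* [Rothvoss2017] T. Rothvoß, *The matching polytope has exponential extension complexity*, J. ACM 64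
  (2017) Art. 41, doi:10.1145/3127497, arXiv:1311.2369 — §4 (PDF p. 13): the approximation notion
  (L3–8), criterion (4) (L10–17), Thm. 16 (L23–25), Cor. 17 and its proof (L37–63).
* [BraunPokutta2014] G. Braun, S. Pokutta, *The matching polytope does not admit fully-polynomial
  size relaxation schemes*, Proc. 26th SODA (2015) 837–846, arXiv:1403.6710 — Thm. 3.1 (the base
  case, not formalised).
* [Edmonds1965] J. Edmonds, *Maximum matching and a polyhedron with 0,1-vertices*, J. Res. Nat. Bur.
  Standards 69B (1965) 125–130 — the description of `P_M` (tree: `EdmondsMatchingPolytope.lean`).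
-/

noncomputable section

open Finset Matrix
open scoped Pointwise

namespace Literature.Combinatorics.Optimization

/-! ### §1 Monotone polytopes and the objective-function criterion -/

section Monotone

variable {ι : Type}

/-- **Monotone (down-monotone) sets** of the nonnegative orthant: "for `x ∈ P` and `0 ≤ y ≤ x` one
also has `y ∈ P`". [cite: Rothvoss2017, §4 (PDF p. 13, L5–6)] -/
def IsDownMonotone (P : Set (ι → ℝ)) : Prop :=
  ∀ ⦃x : ι → ℝ⦄, x ∈ P → ∀ ⦃y : ι → ℝ⦄, (∀ i, 0 ≤ y i) → (∀ i, y i ≤ x i) → y ∈ P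

/-- Unfolding `IsDownMonotone`. [cite: Rothvoss2017, §4 (PDF p. 13, L5–6)] -/
theorem isDownMonotone_iff (P : Set (ι → ℝ)) :
    IsDownMonotone P ↔
      ∀ ⦃x : ι → ℝ⦄, x ∈ P → ∀ ⦃y : ι → ℝ⦄, (∀ i, 0 ≤ y i) → (∀ i, y i ≤ x i) → y ∈ P :=
  Iff.rfl

/-- Positive dilates of monotone sets are monotone (so `(1+ε) P_M` is monotone for `ε > −1`).
[cite: Rothvoss2017, §4 (PDF p. 13, L7–8)] -/
theorem IsDownMonotone.smul {P : Set (ι → ℝ)} (hP : IsDownMonotone P) {t : ℝ} (ht : 0 < t) :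
    IsDownMonotone (t • P) := by
  intro x hx y hy0 hyx
  obtain ⟨z, hz, rfl⟩ := Set.mem_smul_set.1 hx
  refine Set.mem_smul_set.2 ⟨t⁻¹ • y, hP hz (fun i => ?_) (fun i => ?_), ?_⟩
  · rw [Pi.smul_apply, smul_eq_mul]
    exact mul_nonneg (inv_nonneg.2 ht.le) (hy0 i)
  · rw [Pi.smul_apply, smul_eq_mul]
    have h1 : y i ≤ t * z i := by simpa [Pi.smul_apply, smul_eq_mul] using hyx i
    rw [inv_mul_le_iff₀ ht]
    exact h1
  · rw [smul_inv_smul₀ ht.ne']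

variable [Fintype ι]

/-- **Nonnegative objective functions decide membership in a monotone set** (the separation fact
behind "where we use again monotonicity"): if `P ⊆ ℝ^ι_{≥0}` is closed, convex and monotone, and a
point `y ≥ 0` satisfies `c·y ≤ max{c·x : x ∈ P}` (here: `c·y ≤ c·x` for some `x ∈ P`) for every
`c ≥ 0`, then `y ∈ P`.  Proof: a point outside is strictly separated by some linear `c`
(Hahn–Banach); replacing `c` by `c⁺ = max(c,0)` keeps the separation, because `c⁺·x = c·x⁺` with
`x⁺ := x·[c > 0] ∈ P` by monotonicity and `c·y ≤ c⁺·y` for `y ≥ 0`.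
[cite: Rothvoss2017, §4 (PDF p. 13, L10–17)] -/
theorem IsDownMonotone.mem_of_forall_dotProduct_le {P : Set (ι → ℝ)} (hP : IsDownMonotone P)
    (hPc : Convex ℝ P) (hPcl : IsClosed P) (hP0 : ∀ x ∈ P, ∀ i, 0 ≤ x i) {y : ι → ℝ}
    (hy : ∀ i, 0 ≤ y i)
    (h : ∀ c : ι → ℝ, (∀ i, 0 ≤ c i) → ∃ x ∈ P, c ⬝ᵥ y ≤ c ⬝ᵥ x) : y ∈ P := by
  classical
  by_contra hyP
  obtain ⟨f, u, hfP, hfy⟩ := geometric_hahn_banach_closed_point hPc hPcl hyP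
  -- the coordinates of the separating functional
  set c : ι → ℝ := fun i => f (fun j => if i = j then 1 else 0) with hc_def
  have hf : ∀ x : ι → ℝ, f x = c ⬝ᵥ x := by
    intro x
    have h1 := LinearMap.pi_apply_eq_sum_univ (f : (ι → ℝ) →ₗ[ℝ] ℝ) x
    simp only [ContinuousLinearMap.coe_coe, smul_eq_mul] at h1
    rw [h1, dotProduct]
    exact Finset.sum_congr rfl fun i _ => by simp only [hc_def]; ring
  -- its positive part is a nonnegative objective function
  set cp : ι → ℝ := fun i => max (c i) 0 with hcp_def
  obtain ⟨x, hxP, hx⟩ := h cp fun i => le_max_right _ _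
  -- truncate `x` to the coordinates where `c > 0`
  set x' : ι → ℝ := fun i => if 0 < c i then x i else 0 with hx'_def
  have hx'P : x' ∈ P := by
    refine hP hxP (fun i => ?_) (fun i => ?_)
    · by_cases hi : 0 < c i
      · simp only [hx'_def, hi, if_true]; exact hP0 x hxP i
      · simp only [hx'_def, hi, if_false]; exact le_rfl
    · by_cases hi : 0 < c i
      · simp only [hx'_def, hi, if_true]; exact le_rfl
      · simp only [hx'_def, hi, if_false]; exact hP0 x hxP i
  have h1 : cp ⬝ᵥ x = c ⬝ᵥ x' := by
    simp only [dotProduct]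
    refine Finset.sum_congr rfl fun i _ => ?_
    by_cases hi : 0 < c i
    · rw [hcp_def, hx'_def]
      simp only [hi, if_true, max_eq_left hi.le]
    · rw [hcp_def, hx'_def]
      simp only [hi, if_false, mul_zero, max_eq_right (not_lt.1 hi), zero_mul]
  have h2 : c ⬝ᵥ y ≤ cp ⬝ᵥ y := by
    simp only [dotProduct]
    exact Finset.sum_le_sum fun i _ => mul_le_mul_of_nonneg_right (le_max_left _ _) (hy i)
  have h3 := hfP x' hx'P
  rw [hf] at h3 hfy
  linarith

/-- Membership form as an equivalence: for `y ≥ 0`, `y ∈ P` iff every nonnegative objective function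
is at least as large somewhere on `P`. [cite: Rothvoss2017, §4 (PDF p. 13, L10–17)] -/
theorem IsDownMonotone.mem_iff_forall_dotProduct_le {P : Set (ι → ℝ)} (hP : IsDownMonotone P)
    (hPc : Convex ℝ P) (hPcl : IsClosed P) (hP0 : ∀ x ∈ P, ∀ i, 0 ≤ x i) {y : ι → ℝ}
    (hy : ∀ i, 0 ≤ y i) :
    y ∈ P ↔ ∀ c : ι → ℝ, (∀ i, 0 ≤ c i) → ∃ x ∈ P, c ⬝ᵥ y ≤ c ⬝ᵥ x :=
  ⟨fun hyP _ _ => ⟨y, hyP, le_rfl⟩, hP.mem_of_forall_dotProduct_le hPc hPcl hP0 hy⟩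

/-- **Inclusion of monotone sets is decided by nonnegative objective functions**: for
`K ⊆ ℝ^ι_{≥0}` and a closed convex monotone `P ⊆ ℝ^ι_{≥0}`, `K ⊆ P` iff
`max{c·y : y ∈ K} ≤ max{c·x : x ∈ P}` for all `c ≥ 0` (pointwise form).
[cite: Rothvoss2017, §4 (PDF p. 13, L10–17)] -/
theorem IsDownMonotone.subset_iff_forall_dotProduct_le {P K : Set (ι → ℝ)} (hP : IsDownMonotone P)
    (hPc : Convex ℝ P) (hPcl : IsClosed P) (hP0 : ∀ x ∈ P, ∀ i, 0 ≤ x i)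
    (hK0 : ∀ y ∈ K, ∀ i, 0 ≤ y i) :
    K ⊆ P ↔ ∀ c : ι → ℝ, (∀ i, 0 ≤ c i) → ∀ y ∈ K, ∃ x ∈ P, c ⬝ᵥ y ≤ c ⬝ᵥ x :=
  ⟨fun hKP _ _ y hy => ⟨y, hKP hy, le_rfl⟩, fun h _ hy =>
    hP.mem_of_forall_dotProduct_le hPc hPcl hP0 (hK0 _ hy) fun c hc => h c hc _ hy⟩

end Monotone

/-! ### The matching polytope is a monotone polytope -/

section Matching

open StephenTuncel1999

variable {V : Type} [Fintype V] [DecidableEq V] {G : SimpleGraph V} [DecidableRel G.Adj]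

/-- Points of the matching polytope are nonnegative (Edmonds' inequality (1)).
[cite: Edmonds1965, §2 (1) (p. 125)] -/
theorem nonneg_of_mem_edmondsPolytope {x : G.edgeSet → ℝ} (hx : x ∈ edmondsPolytope G)
    (e : G.edgeSet) : 0 ≤ x e :=
  hx.1 e

/-- **"The polytope `P_M` has the nice property that it is monotone"**: Edmonds' inequalities (2) and
(3) are sums of coordinates with coefficients `0/1`, so they are inherited by any `0 ≤ y ≤ x`.
[cite: Rothvoss2017, §4 (PDF p. 13, L5–6)] -/
theorem isDownMonotone_edmondsPolytope : IsDownMonotone (edmondsPolytope G) := by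
  intro x hx y hy0 hyx
  refine ⟨hy0, fun v => le_trans (Finset.sum_le_sum fun e _ => hyx e) (hx.2.1 v), fun S hS => ?_⟩
  exact le_trans (Finset.sum_le_sum fun e _ => hyx e) (hx.2.2 S hS)

/-- The matching vectors form a finite set (they are `0/1` vectors). [folklore] -/
private theorem matchingVectors_finite : (matchingVectors G).Finite := by
  refine Set.Finite.subset (Set.Finite.pi (t := fun _ : G.edgeSet => ({0, 1} : Set ℝ))
    fun _ => Set.toFinite _) fun y hy => ?_
  exact Set.mem_univ_pi.2 fun e => by
    rcases hy.1 e with h | h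
    · rw [h]; exact Set.mem_insert _ _
    · rw [h]; exact Set.mem_insert_of_mem _ (Set.mem_singleton _)

/-- The matching polytope is compact (a convex hull of finitely many points, by Edmonds' theorem).
[cite: Edmonds1965, Thm. (P) (p. 126)] -/
theorem isCompact_edmondsPolytope : IsCompact (edmondsPolytope G) := by
  rw [edmondsPolytope_eq_convexHull]
  exact Set.Finite.isCompact_convexHull ℝ matchingVectors_finite

/-- The matching polytope is closed. [cite: Edmonds1965, Thm. (P) (p. 126)] -/
theorem isClosed_edmondsPolytope : IsClosed (edmondsPolytope G) :=
  isCompact_edmondsPolytope.isClosed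

/-- **Criterion (4)**: for a closed convex MONOTONE `K ⊆ ℝ^E_{≥0}` and `ε ≥ 0`, `K` is a
`(1+ε)`-approximation of `P_M(G)` — `P_M ⊆ K ⊆ (1+ε) P_M` — iff for every objective function `c ≥ 0`,
`max{cx : x ∈ P_M} ≤ max{cx : x ∈ K} ≤ (1+ε) · max{cx : x ∈ P_M}`, both inequalities written
pointwise (for every point of the smaller side there is a point of the larger side with at least that
objective value; for compact sets this is the printed `max` form).  (The direction "⇒" needs none of
the hypotheses on `K`; "⇐" uses monotonicity of `K` for the first inclusion and of `(1+ε)P_M` for the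
second, as printed: "note that this only makes sense for monotone polytopes […] where we use again
monotonicity".) [cite: Rothvoss2017, §4 eq. (4) (PDF p. 13, L7–17)] -/
theorem approximation_iff_objective {K : Set (G.edgeSet → ℝ)} (hK : IsDownMonotone K)
    (hKc : Convex ℝ K) (hKcl : IsClosed K) (hK0 : ∀ x ∈ K, ∀ e, 0 ≤ x e) {ε : ℝ} (hε : 0 ≤ ε) :
    (edmondsPolytope G ⊆ K ∧ K ⊆ (1 + ε) • edmondsPolytope G) ↔
      ∀ c : G.edgeSet → ℝ, (∀ e, 0 ≤ c e) →
        (∀ y ∈ edmondsPolytope G, ∃ x ∈ K, c ⬝ᵥ y ≤ c ⬝ᵥ x) ∧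
          (∀ x ∈ K, ∃ y ∈ edmondsPolytope G, c ⬝ᵥ x ≤ (1 + ε) * (c ⬝ᵥ y)) := by
  have hε1 : 0 < 1 + ε := by linarith
  -- the dilate `(1+ε) P_M` is again closed, convex, monotone and nonnegative
  have hD : IsDownMonotone ((1 + ε) • edmondsPolytope G) := isDownMonotone_edmondsPolytope.smul hε1
  have hDc : Convex ℝ ((1 + ε) • edmondsPolytope G) := convex_edmondsPolytope.smul _
  have hDcl : IsClosed ((1 + ε) • edmondsPolytope G) :=
    isClosed_edmondsPolytope.smul_of_ne_zero hε1.ne'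
  have hD0 : ∀ x ∈ (1 + ε) • edmondsPolytope G, ∀ e, 0 ≤ x e := by
    intro x hx e
    obtain ⟨z, hz, rfl⟩ := Set.mem_smul_set.1 hx
    rw [Pi.smul_apply, smul_eq_mul]
    exact mul_nonneg hε1.le (hz.1 e)
  -- pointwise objective comparison with the dilate = comparison with `P_M` up to the factor `1+ε`
  have hdil : ∀ (c x : G.edgeSet → ℝ),
      (∃ y ∈ (1 + ε) • edmondsPolytope G, c ⬝ᵥ x ≤ c ⬝ᵥ y) ↔
        ∃ y ∈ edmondsPolytope G, c ⬝ᵥ x ≤ (1 + ε) * (c ⬝ᵥ y) := by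
    intro c x
    constructor
    · rintro ⟨y, hy, hle⟩
      obtain ⟨z, hz, rfl⟩ := Set.mem_smul_set.1 hy
      refine ⟨z, hz, ?_⟩
      rwa [dotProduct_smul, smul_eq_mul] at hle
    · rintro ⟨y, hy, hle⟩
      refine ⟨(1 + ε) • y, Set.smul_mem_smul_set hy, ?_⟩
      rwa [dotProduct_smul, smul_eq_mul]
  have hP0 : ∀ x ∈ edmondsPolytope G, ∀ e, 0 ≤ x e := fun x hx e => hx.1 e
  rw [hK.subset_iff_forall_dotProduct_le hKc hKcl hK0 hP0,
    hD.subset_iff_forall_dotProduct_le hDc hDcl hD0 hK0]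
  constructor
  · intro h c hc
    exact ⟨h.1 c hc, fun x hx => (hdil c x).1 (h.2 c hc x hx)⟩
  · intro h
    exact ⟨fun c hc => (h c hc).1, fun c hc x hx => (hdil c x).2 ((h c hc).2 x hx)⟩

end Matching

/-! ### §2 Restricting approximate extended formulations to subgraphs (Corollary 17's reduction) -/

section EdgeMaps

variable {V : Type} {G H : SimpleGraph V}

/-- The edge inclusion `E(H) ↪ E(G)` of a subgraph `H ≤ G`. [cite: Rothvoss2017, Cor. 17 proof (PDF p. 13, L48–50)] -/
def edgeIncl (hHG : H ≤ G) (e : H.edgeSet) : G.edgeSet :=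
  ⟨e.1, SimpleGraph.edgeSet_subset_edgeSet.2 hHG e.2⟩

/-- The underlying pair of an included edge. [cite: Rothvoss2017, Cor. 17 proof (PDF p. 13, L48–50)] -/
@[simp] theorem coe_edgeIncl (hHG : H ≤ G) (e : H.edgeSet) :
    ((edgeIncl hHG e : G.edgeSet) : Sym2 V) = (e : Sym2 V) :=
  rfl

/-- The edge inclusion is injective. [cite: Rothvoss2017, Cor. 17 proof (PDF p. 13, L48–50)] -/
theorem edgeIncl_injective (hHG : H ≤ G) : Function.Injective (edgeIncl hHG) := by
  intro a b h
  have h1 := congrArg (fun e : G.edgeSet => (e : Sym2 V)) h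
  exact Subtype.ext h1

/-- **Extension by zero** `x' ↦ (x', 0) ∈ ℝ^E` of a vector `x' ∈ ℝ^{E'}` on the edges of the subgraph.
[cite: Rothvoss2017, Cor. 17 proof (PDF p. 13, L49–53: "x = (x',x'')", "((x',0),y) ∈ Q")] -/
def extendZero (hHG : H ≤ G) (x' : H.edgeSet → ℝ) : G.edgeSet → ℝ :=
  Function.extend (edgeIncl hHG) x' 0

/-- **Restriction** `x ↦ x'` of a vector of `ℝ^E` to the edges of the subgraph.
[cite: Rothvoss2017, Cor. 17 proof (PDF p. 13, L49–50)] -/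
def restrictEdges (hHG : H ≤ G) (x : G.edgeSet → ℝ) : H.edgeSet → ℝ :=
  fun e => x (edgeIncl hHG e)

/-- `(x',0)` agrees with `x'` on `E(H)`. [cite: Rothvoss2017, Cor. 17 proof (PDF p. 13, L49–53)] -/
@[simp] theorem extendZero_apply_edgeIncl (hHG : H ≤ G) (x' : H.edgeSet → ℝ) (e : H.edgeSet) :
    extendZero hHG x' (edgeIncl hHG e) = x' e :=
  (edgeIncl_injective hHG).extend_apply _ _ _

/-- `(x',0)` vanishes off `E(H)`. [cite: Rothvoss2017, Cor. 17 proof (PDF p. 13, L49–53)] -/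
theorem extendZero_apply_of_not_mem (hHG : H ≤ G) (x' : H.edgeSet → ℝ) {e : G.edgeSet}
    (he : (e : Sym2 V) ∉ H.edgeSet) : extendZero hHG x' e = 0 := by
  unfold extendZero
  rw [Function.extend_apply']
  · rfl
  · rintro ⟨a, rfl⟩
    exact he a.2

/-- `(x',0)' = x'`. [cite: Rothvoss2017, Cor. 17 proof (PDF p. 13, L49–53)] -/
@[simp] theorem restrictEdges_extendZero (hHG : H ≤ G) (x' : H.edgeSet → ℝ) :
    restrictEdges hHG (extendZero hHG x') = x' :=
  funext fun e => extendZero_apply_edgeIncl hHG x' e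

/-- A vector vanishing off `E(H)` is `(x',0)` for its restriction `x'`.
[cite: Rothvoss2017, Cor. 17 proof (PDF p. 13, L49–53)] -/
theorem extendZero_restrictEdges (hHG : H ≤ G) {x : G.edgeSet → ℝ}
    (hx : ∀ e : G.edgeSet, (e : Sym2 V) ∉ H.edgeSet → x e = 0) :
    extendZero hHG (restrictEdges hHG x) = x := by
  funext e
  by_cases he : (e : Sym2 V) ∈ H.edgeSet
  · have h1 : e = edgeIncl hHG ⟨e, he⟩ := Subtype.ext rfl
    rw [h1, extendZero_apply_edgeIncl]
    rfl
  · rw [extendZero_apply_of_not_mem hHG _ he, hx e he]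

/-- Restriction commutes with scalars. [folklore] -/
private theorem restrictEdges_smul (hHG : H ≤ G) (t : ℝ) (x : G.edgeSet → ℝ) :
    restrictEdges hHG (t • x) = t • restrictEdges hHG x :=
  rfl

/-- Transfer of `0/1`-coefficient sums along the edge inclusion, for `(x',0)`: if the index sets
`A ⊆ E(G)` and `B ⊆ E(H)` correspond under the inclusion, `Σ_{e ∈ A} (x',0)_e = Σ_{e ∈ B} x'_e`.
[cite: Rothvoss2017, Cor. 17 proof (PDF p. 13, L54–57)] -/
private theorem sum_extendZero_eq (hHG : H ≤ G) (x' : H.edgeSet → ℝ) {A : Finset G.edgeSet}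
    {B : Finset H.edgeSet} (hAB : ∀ e : H.edgeSet, e ∈ B ↔ edgeIncl hHG e ∈ A) :
    ∑ e ∈ A, extendZero hHG x' e = ∑ e ∈ B, x' e := by
  have h1 : ∑ e ∈ B, x' e =
      ∑ e ∈ B.map ⟨edgeIncl hHG, edgeIncl_injective hHG⟩, extendZero hHG x' e := by
    rw [Finset.sum_map]
    exact Finset.sum_congr rfl fun e _ => (extendZero_apply_edgeIncl hHG x' e).symm
  rw [h1]
  symm
  apply Finset.sum_subset
  · intro e he
    rw [Finset.mem_map] at he
    obtain ⟨a, ha, rfl⟩ := he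
    exact (hAB a).1 ha
  · intro e heA hemap
    by_cases he : (e : Sym2 V) ∈ H.edgeSet
    · exfalso
      apply hemap
      rw [Finset.mem_map]
      have h2 : edgeIncl hHG ⟨e, he⟩ = e := Subtype.ext rfl
      refine ⟨⟨e, he⟩, (hAB _).2 (by rw [h2]; exact heA), h2⟩
    · exact extendZero_apply_of_not_mem hHG _ he

/-- Transfer of `0/1`-coefficient sums along the edge inclusion, for the restriction of a nonnegative
vector: `Σ_{e ∈ B} x'_e ≤ Σ_{e ∈ A} x_e` when `B` maps into `A`. [cite: Rothvoss2017, Cor. 17 proof (PDF p. 13, L54–57)] -/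
private theorem sum_restrictEdges_le (hHG : H ≤ G) {x : G.edgeSet → ℝ} (hx : ∀ e, 0 ≤ x e)
    {A : Finset G.edgeSet} {B : Finset H.edgeSet} (hAB : ∀ e : H.edgeSet, e ∈ B → edgeIncl hHG e ∈ A) :
    ∑ e ∈ B, restrictEdges hHG x e ≤ ∑ e ∈ A, x e := by
  have h1 : ∑ e ∈ B, restrictEdges hHG x e =
      ∑ e ∈ B.map ⟨edgeIncl hHG, edgeIncl_injective hHG⟩, x e := by
    rw [Finset.sum_map]
    rfl
  rw [h1]
  refine Finset.sum_le_sum_of_subset_of_nonneg (fun e he => ?_) fun e _ _ => hx e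
  rw [Finset.mem_map] at he
  obtain ⟨a, ha, rfl⟩ := he
  exact hAB a ha

/-- **The restricted polytope `K' := {x' ∈ ℝ^{E'} | (x',0) ∈ K}`** ("`K'` emerges from `K` by
'deleting' variables for edges that are not in `G'`"). [cite: Rothvoss2017, Cor. 17 proof (PDF p. 13, L51–53)] -/
def restrictPolytope (hHG : H ≤ G) (K : Set (G.edgeSet → ℝ)) : Set (H.edgeSet → ℝ) :=
  {x' | extendZero hHG x' ∈ K}

/-- Unfolding `restrictPolytope`. [cite: Rothvoss2017, Cor. 17 proof (PDF p. 13, L51–53)] -/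
theorem mem_restrictPolytope (hHG : H ≤ G) (K : Set (G.edgeSet → ℝ)) (x' : H.edgeSet → ℝ) :
    x' ∈ restrictPolytope hHG K ↔ extendZero hHG x' ∈ K :=
  Iff.rfl

/-- `K'` is the coordinate projection of the coordinate section `K ∩ {x_e = 0 (e ∉ E')}`.
[cite: Rothvoss2017, Cor. 17 proof (PDF p. 13, L51–53)] -/
theorem restrictPolytope_eq_image (hHG : H ≤ G) (K : Set (G.edgeSet → ℝ)) :
    restrictPolytope hHG K =
      (LinearMap.funLeft ℝ ℝ (edgeIncl hHG)) ''
        (K ∩ {x | ∀ e : G.edgeSet, (e : Sym2 V) ∉ H.edgeSet → x e = 0}) := by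
  ext x'
  simp only [mem_restrictPolytope, Set.mem_image, Set.mem_inter_iff, Set.mem_setOf_eq]
  constructor
  · intro hx'
    refine ⟨extendZero hHG x', ⟨hx', fun e he => extendZero_apply_of_not_mem hHG _ he⟩, ?_⟩
    funext e
    rw [LinearMap.funLeft_apply, extendZero_apply_edgeIncl]
  · rintro ⟨x, ⟨hxK, hx0⟩, rfl⟩
    have h1 : (LinearMap.funLeft ℝ ℝ (edgeIncl hHG)) x = restrictEdges hHG x := by
      funext e
      rw [LinearMap.funLeft_apply]
      rfl
    rw [h1, extendZero_restrictEdges hHG hx0]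
    exact hxK

end EdgeMaps

section Restrict

open StephenTuncel1999
open Literature.Barriers.PneNP (HasEFOfSize)

variable {V : Type} [Fintype V] [DecidableEq V] {G H : SimpleGraph V} [DecidableRel G.Adj]
  [DecidableRel H.Adj]

/-- The edges at a vertex correspond under the inclusion. [folklore] -/
private theorem mem_filter_vertex_iff (hHG : H ≤ G) (v : V) (e : H.edgeSet) :
    e ∈ univ.filter (fun e : H.edgeSet => v ∈ (e : Sym2 V)) ↔
      edgeIncl hHG e ∈ univ.filter (fun e : G.edgeSet => v ∈ (e : Sym2 V)) := by
  simp only [Finset.mem_filter, Finset.mem_univ, true_and, coe_edgeIncl]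

/-- The edges inside a vertex set correspond under the inclusion (`E_H[S] = E_G[S] ∩ E(H)`).
[folklore] -/
private theorem mem_edgesIn_iff (hHG : H ≤ G) (S : Finset V) (e : H.edgeSet) :
    e ∈ edgesIn H S ↔ edgeIncl hHG e ∈ edgesIn G S := by
  simp only [edgesIn, Finset.mem_filter, Finset.mem_univ, true_and, coe_edgeIncl]

/-- **A matching-polytope point of the subgraph, extended by zero, lies in the matching polytope of
the graph** (`x' ∈ P_M(G') ⇒ (x',0) ∈ P_M(G)`; a matching of `G'` is a matching of `G`) — read off
Edmonds' inequalities, whose left-hand sides transfer along the edge inclusion.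
[cite: Rothvoss2017, Cor. 17 proof (PDF p. 13, L54–57: "P_M(G') ⊆ K'")] -/
theorem extendZero_mem_edmondsPolytope (hHG : H ≤ G) {x' : H.edgeSet → ℝ}
    (hx' : x' ∈ edmondsPolytope H) : extendZero hHG x' ∈ edmondsPolytope G := by
  obtain ⟨h0, hdeg, hodd⟩ := hx'
  refine ⟨fun e => ?_, fun v => ?_, fun S hS => ?_⟩
  · by_cases he : (e : Sym2 V) ∈ H.edgeSet
    · have h1 : e = edgeIncl hHG ⟨e, he⟩ := Subtype.ext rfl
      rw [h1, extendZero_apply_edgeIncl]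
      exact h0 _
    · rw [extendZero_apply_of_not_mem hHG _ he]
  · rw [sum_extendZero_eq hHG x' (B := univ.filter fun e : H.edgeSet => v ∈ (e : Sym2 V))
      (fun e => mem_filter_vertex_iff hHG v e)]
    exact hdeg v
  · rw [sum_extendZero_eq hHG x' (B := edgesIn H S) (fun e => mem_edgesIn_iff hHG S e)]
    exact hodd S hS

/-- **A matching-polytope point of the graph restricts to a matching-polytope point of the
subgraph** (`x ∈ P_M(G) ⇒ x' ∈ P_M(G')`; in particular `(x',0) ∈ P_M(G) ⇒ x' ∈ P_M(G')`, the
inclusion behind "`K' ⊆ (1+ε) P_M(G')`") — Edmonds' inequalities for `G'` are partial sums of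
those for `G`, all coordinates being nonnegative.
[cite: Rothvoss2017, Cor. 17 proof (PDF p. 13, L54–57: "K' ⊆ (1+ε) P_M(G')")] -/
theorem restrictEdges_mem_edmondsPolytope (hHG : H ≤ G) {x : G.edgeSet → ℝ}
    (hx : x ∈ edmondsPolytope G) : restrictEdges hHG x ∈ edmondsPolytope H := by
  obtain ⟨h0, hdeg, hodd⟩ := hx
  refine ⟨fun e => h0 _, fun v => ?_, fun S hS => ?_⟩
  · exact le_trans (sum_restrictEdges_le hHG h0 fun e he => (mem_filter_vertex_iff hHG v e).1 he)
      (hdeg v)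
  · exact le_trans (sum_restrictEdges_le hHG h0 fun e he => (mem_edgesIn_iff hHG S e).1 he)
      (hodd S hS)

/-- **`xc(K') ≤ xc(K)`**: an extended formulation of `K` of size `r` gives one of `K'` of size `r`
(setting variables to zero and projecting are free in the slack-form currency).
[cite: Rothvoss2017, Cor. 17 proof (PDF p. 13, L51–53: "K' […] is a polytope with xc(K') ≤ xc(K)")] -/
theorem hasEFOfSize_restrictPolytope (hHG : H ≤ G) {K : Set (G.edgeSet → ℝ)} {r : ℕ}
    (hK : HasEFOfSize K r) : HasEFOfSize (restrictPolytope hHG K) r := by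
  classical
  rw [restrictPolytope_eq_image]
  -- the coordinate section as a system of equations `e_t · x = 0`, `t ∉ E(H)`
  have hS : (K ∩ {x : G.edgeSet → ℝ | ∀ t : {e : G.edgeSet // (e : Sym2 V) ∉ H.edgeSet},
      Pi.single (t.1) (1 : ℝ) ⬝ᵥ x = (fun _ => (0 : ℝ)) t}) =
      K ∩ {x | ∀ e : G.edgeSet, (e : Sym2 V) ∉ H.edgeSet → x e = 0} := by
    ext x
    simp only [Set.mem_inter_iff, Set.mem_setOf_eq, single_dotProduct, one_mul]
    exact ⟨fun h => ⟨h.1, fun e he => h.2 ⟨e, he⟩⟩, fun h => ⟨h.1, fun t => h.2 t.1 t.2⟩⟩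
  have h := (hK.inter_eqs (T := {e : G.edgeSet // (e : Sym2 V) ∉ H.edgeSet})
    (fun t => Pi.single (t.1) (1 : ℝ)) (fun _ => 0)).image_linearMap
    (LinearMap.funLeft ℝ ℝ (edgeIncl hHG))
  rw [hS] at h
  exact h

/-- **Corollary 17's reduction: `P_M(G') ⊆ K' ⊆ (1+ε) P_M(G')`** — the restriction `K'` of a
`(1+ε)`-approximation `K` of `P_M(G)` is a `(1+ε)`-approximation of `P_M(G')`, for every subgraph
`G' = H ≤ G` (the first inclusion by `extendZero_mem_edmondsPolytope`, the second by
`restrictEdges_mem_edmondsPolytope` applied to `(1+ε)^{-1}(x',0) ∈ P_M(G)`, written without the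
division so that it holds for every real `ε`). [cite: Rothvoss2017, Cor. 17 proof (PDF p. 13, L54–57)] -/
theorem approximation_restrictPolytope (hHG : H ≤ G) {K : Set (G.edgeSet → ℝ)} {ε : ℝ}
    (hPK : edmondsPolytope G ⊆ K) (hKP : K ⊆ (1 + ε) • edmondsPolytope G) :
    edmondsPolytope H ⊆ restrictPolytope hHG K ∧
      restrictPolytope hHG K ⊆ (1 + ε) • edmondsPolytope H := by
  refine ⟨fun x' hx' => hPK (extendZero_mem_edmondsPolytope hHG hx'), fun x' hx' => ?_⟩
  obtain ⟨z, hz, hzx⟩ := Set.mem_smul_set.1 (hKP hx')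
  refine Set.mem_smul_set.2 ⟨restrictEdges hHG z, restrictEdges_mem_edmondsPolytope hHG hz, ?_⟩
  rw [← restrictEdges_smul, hzx, restrictEdges_extendZero]

/-- **Approximate extended formulations of the matching polytope restrict to subgraphs** (the
reduction in the proof of Corollary 17, packaged): if `P_M(G) ⊆ K ⊆ (1+ε) P_M(G)` and `K` has an
extended formulation of size `r`, then some `K'` with `P_M(G') ⊆ K' ⊆ (1+ε) P_M(G')` has an extended
formulation of size `r`, for every subgraph `G' = H ≤ G` on the same vertex set.  Printed for
`G = K_n` and `G'` the complete graph on `k = ½⌊1/ε⌋` of the vertices (plus, in this same-vertex-set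
phrasing, `n − k` isolated vertices, which carry no coordinates), where Braun–Pokutta's theorem
(Thm. 16, NOT in the tree) then gives `r ≥ 2^{Ω(k)}`, i.e. Cor. 17: `xc(K) ≥ 2^{Ω(min{1/ε, n})}`.
[cite: Rothvoss2017, Cor. 17 proof (PDF p. 13, L44–63)] -/
theorem exists_approximation_of_subgraph (hHG : H ≤ G) {K : Set (G.edgeSet → ℝ)} {ε : ℝ} {r : ℕ}
    (hPK : edmondsPolytope G ⊆ K) (hKP : K ⊆ (1 + ε) • edmondsPolytope G) (hK : HasEFOfSize K r) :
    ∃ K' : Set (H.edgeSet → ℝ),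
      edmondsPolytope H ⊆ K' ∧ K' ⊆ (1 + ε) • edmondsPolytope H ∧ HasEFOfSize K' r :=
  ⟨restrictPolytope hHG K, (approximation_restrictPolytope hHG hPK hKP).1,
    (approximation_restrictPolytope hHG hPK hKP).2, hasEFOfSize_restrictPolytope hHG hK⟩

/-- The exact case `ε = 0` (`K = P_M(G)`): **the matching polytope of a subgraph inherits extended
formulations** — `xc(P_M(G')) ≤ xc(P_M(G))` for `G' ≤ G` (here `K' = P_M(G')` on the nose, since
`P_M(G') ⊆ K' ⊆ 1 • P_M(G')`). [cite: Rothvoss2017, Cor. 17 proof (PDF p. 13, L51–57), with ε = 0] -/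
theorem hasEFOfSize_edmondsPolytope_of_subgraph (hHG : H ≤ G) {r : ℕ}
    (h : HasEFOfSize (edmondsPolytope G) r) : HasEFOfSize (edmondsPolytope H) r := by
  have happ := approximation_restrictPolytope hHG (K := edmondsPolytope G) (ε := 0) subset_rfl
    (subset_of_eq (by rw [add_zero, one_smul]))
  rw [add_zero, one_smul] at happ
  have heq : restrictPolytope hHG (edmondsPolytope G) = edmondsPolytope H :=
    Set.Subset.antisymm happ.2 happ.1
  rw [← heq]
  exact hasEFOfSize_restrictPolytope hHG h

end Restrict

/-! ### §3 The semidefinite version: psd lifts restrict to subgraphs (appended) -/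

section PsdRestrictMaps

variable {V : Type} {G H : SimpleGraph V}

/-- **Coordinate restriction is free for psd lifts**: if `K = π(S^k_+ ∩ L)` then
`K' = {x' | (x',0) ∈ K}` — the coordinate projection of the affine section `K ∩ {x_e = 0 (e ∉ E')}` —
has a psd lift of the same size `k` (GPT 2013 Prop. 2.8 (3): sections by affine subspaces add
equations to `L`; linear images compose with `π`). [cite: Rothvoss2017, Cor. 17 proof (PDF p. 13, L51–53) and §4.2 (PDF p. 13)] -/
theorem hasPsdLift_restrictPolytope (hHG : H ≤ G) {K : Set (G.edgeSet → ℝ)} {k : ℕ}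
    (hK : HasPsdLift K k) : HasPsdLift (restrictPolytope hHG K) k := by
  rw [restrictPolytope_eq_image]
  -- the coordinate section `{x | x_e = 0 for e ∉ E(H)}` as the kernel of the restriction to those edges
  have hsec : (K ∩ {x : G.edgeSet → ℝ | ∀ e : G.edgeSet, (e : Sym2 V) ∉ H.edgeSet → x e = 0}) =
      K ∩ {x | (LinearMap.funLeft ℝ ℝ
        (Subtype.val : {e : G.edgeSet // (e : Sym2 V) ∉ H.edgeSet} → G.edgeSet)) x = 0} := by
    ext x
    simp only [Set.mem_inter_iff, Set.mem_setOf_eq, funext_iff, LinearMap.funLeft_apply,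
      Pi.zero_apply, Subtype.forall]
  rw [hsec]
  exact (hK.inter_setOf_map_eq _ 0).image _

end PsdRestrictMaps

section PsdRestrict

open StephenTuncel1999

variable {V : Type} [Fintype V] [DecidableEq V] {G H : SimpleGraph V} [DecidableRel G.Adj]
  [DecidableRel H.Adj]

/-- **Restricting the matching polytope itself gives the matching polytope of the subgraph**:
`{x' | (x',0) ∈ P_M(G)} = P_M(H)` (the case `K = P_M(G)`, `ε = 0` of Corollary 17's reduction).
[cite: Rothvoss2017, Cor. 17 proof (PDF p. 13, L54–57), with ε = 0] -/
theorem restrictPolytope_edmondsPolytope (hHG : H ≤ G) :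
    restrictPolytope hHG (edmondsPolytope G) = edmondsPolytope H := by
  have happ := approximation_restrictPolytope hHG (K := edmondsPolytope G) (ε := 0) subset_rfl
    (subset_of_eq (by rw [add_zero, one_smul]))
  rw [add_zero, one_smul] at happ
  exact Set.Subset.antisymm happ.2 happ.1

/-- **Semidefinite approximations of the matching polytope restrict to subgraphs**: if
`P_M(G) ⊆ K ⊆ (1+ε) P_M(G)` and `K` has a psd lift of size `k` (`K = π(S^k_+ ∩ L)`), then some `K'`
with `P_M(G') ⊆ K' ⊆ (1+ε) P_M(G')` has a psd lift of size `k`, for every subgraph `G' = H ≤ G` —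
Corollary 17's reduction read for semidefinite extended formulations ("it is still unknown whether
there is a polynomial size SDP for the perfect matching polytope", §4.2).
[cite: Rothvoss2017, Cor. 17 proof (PDF p. 13, L44–57) and §4.2 (PDF p. 13)] -/
theorem exists_psdApproximation_of_subgraph (hHG : H ≤ G) {K : Set (G.edgeSet → ℝ)} {ε : ℝ}
    {k : ℕ} (hPK : edmondsPolytope G ⊆ K) (hKP : K ⊆ (1 + ε) • edmondsPolytope G)
    (hK : HasPsdLift K k) :
    ∃ K' : Set (H.edgeSet → ℝ),
      edmondsPolytope H ⊆ K' ∧ K' ⊆ (1 + ε) • edmondsPolytope H ∧ HasPsdLift K' k :=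
  ⟨restrictPolytope hHG K, (approximation_restrictPolytope hHG hPK hKP).1,
    (approximation_restrictPolytope hHG hPK hKP).2, hasPsdLift_restrictPolytope hHG hK⟩

/-- **Semidefinite extension complexity of matching polytopes is monotone under subgraphs**: a
psd lift of `P_M(G)` of size `k` gives one of `P_M(H)` of size `k` for `H ≤ G`; equivalently, a
lower bound on the size of psd lifts of `P_M(H)` is a lower bound for every supergraph on the same
vertex set. [cite: Rothvoss2017, Cor. 17 proof (PDF p. 13, L51–57) and §4.2 (PDF p. 13)] -/
theorem hasPsdLift_edmondsPolytope_of_subgraph (hHG : H ≤ G) {k : ℕ}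
    (h : HasPsdLift (edmondsPolytope G) k) : HasPsdLift (edmondsPolytope H) k := by
  rw [← restrictPolytope_edmondsPolytope hHG]
  exact hasPsdLift_restrictPolytope hHG h

end PsdRestrict

end Literature.Combinatorics.Optimization

end
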